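import Mathlib
import Literature.AlgebraicGeometry.Resolution.AxisPolyhedron

/-!
# `WeightedInvariant.LocalWeightedDrop`, line `hasse-ridge-face-selection`: the level of the weighted move

Crux item stmt-ResolutionOfSingularities-8899 (route `ResolutionOfSingularities/WeightedInvariant`),
skeleton v18 of the line `hasse-ridge-face-selection`, registered helper stub `stub_axisWeightedMoveLevel`
(helper of B2 `stub_axisWeightedMove`), PROVED here (statement verbatim from the ledger registration).

**Statement (Hironaka's `δ`-arithmetic over `ℕ`).**  Let `g ∈ k[[x'₁, …, x'ₙ, z]]` (`z = Fin.last n`) have a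
monomial `x'^a z^c` with `|a| < d`, and suppose every such monomial satisfies `c > d - |a|` (i.e. every slope
`c / (d - |a|)` is `> 1`).  Then there is a level `m ≥ 1` with `p ∤ m` such that `m ≤ δ(g; x'; z)`
(`m (d - |a|) ≤ c` for every monomial with `|a| < d`) and `δ < m + 2` (some monomial has `c < (m + 2)(d - |a|)`).

**Proof.**  The predicate `P m := ∀ monomials, m (d - |a|) ≤ c` holds at `m = 0, 1` and fails at `m = c_w + 1`
for the given monomial `x'^{a_w} z^{c_w}`; let `m₁ ≥ 2` be the least failure (`Nat.find`) and `m₀ := m₁ - 1`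
(`= ⌊δ⌋ ≥ 1`, `P m₀`, `¬ P (m₀ + 1)`).  Take `m := m₀` if `p ∤ m₀`, else `m := m₀ - 1` (`≥ 1` as `m₀ ≥ p ≥ 2`,
and `p ∤ m₀ - 1`); the witness of `¬ P (m₀ + 1)` has `c < (m₀ + 1)(d - |a|) ≤ (m + 2)(d - |a|)`.
-/

set_option linter.dupNamespace false -- mandated namespace of this single-conjunct summit

namespace Summit.ResolutionOfSingularities.ResolutionOfSingularities.Theorems

open Literature.AlgebraicGeometry.Resolution

/-- THE LEVEL OF THE WEIGHTED MOVE, registered helper stub `stub_axisWeightedMoveLevel` of B2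
(`stub_axisWeightedMove`) of the line `hasse-ridge-face-selection` of crux `LocalWeightedDrop`
(stmt-ResolutionOfSingularities-8899): if `g` has a monomial `x'^a z^c` with `|a| < d` and all such monomials
have `c > d - |a|`, then some `m ≥ 1` with `p ∤ m` has `m (d - |a|) ≤ c` on all of them and
`c < (m + 2)(d - |a|)` on one of them (`m = ⌊δ⌋` if `p ∤ ⌊δ⌋`, else `⌊δ⌋ - 1`, for Hironaka's
`δ = min c / (d - |a|)`; pure `ℕ`-arithmetic via `Nat.find`). -/
theorem stub_axisWeightedMoveLevel : ∀ (p : ℕ), p.Prime → ∀ (k : Type) [Field k] (n d : ℕ)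
    (g : MvPowerSeries (Fin (n + 1)) k),
    (∃ E : Fin (n + 1) →₀ ℕ, AxisPolyhedron.xDeg E < d ∧ MvPowerSeries.coeff E g ≠ 0) →
    (∀ E : Fin (n + 1) →₀ ℕ, AxisPolyhedron.xDeg E < d → MvPowerSeries.coeff E g ≠ 0 →
      d - AxisPolyhedron.xDeg E < E (Fin.last n)) →
    ∃ m : ℕ, 1 ≤ m ∧ ¬ p ∣ m ∧
      (∀ E : Fin (n + 1) →₀ ℕ, AxisPolyhedron.xDeg E < d → MvPowerSeries.coeff E g ≠ 0 →
        m * (d - AxisPolyhedron.xDeg E) ≤ E (Fin.last n)) ∧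
      ∃ E₀ : Fin (n + 1) →₀ ℕ, AxisPolyhedron.xDeg E₀ < d ∧ MvPowerSeries.coeff E₀ g ≠ 0 ∧
        E₀ (Fin.last n) < (m + 2) * (d - AxisPolyhedron.xDeg E₀) := by
  intro p hp k _ n d g hex hgt
  classical
  -- the predicate "level `m` lies below the polyhedron"
  set P : ℕ → Prop := fun m => ∀ E : Fin (n + 1) →₀ ℕ, AxisPolyhedron.xDeg E < d →
    MvPowerSeries.coeff E g ≠ 0 → m * (d - AxisPolyhedron.xDeg E) ≤ E (Fin.last n) with hP
  have hP1 : P 1 := fun E hEx hEg => by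
    rw [one_mul]
    exact (hgt E hEx hEg).le
  have hP0 : P 0 := fun E _ _ => by
    rw [zero_mul]
    exact Nat.zero_le _
  -- it fails at the level `c_w + 1` of the given monomial
  obtain ⟨Ew, hEwx, hEwg⟩ := hex
  have hfail : ∃ m, ¬ P m := by
    refine ⟨Ew (Fin.last n) + 1, fun h => ?_⟩
    have h1 := h Ew hEwx hEwg
    have hpos : 1 ≤ d - AxisPolyhedron.xDeg Ew := Nat.one_le_iff_ne_zero.mpr (by omega)
    have : (Ew (Fin.last n) + 1) * 1 ≤ (Ew (Fin.last n) + 1) * (d - AxisPolyhedron.xDeg Ew) :=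
      Nat.mul_le_mul_left _ hpos
    omega
  -- the least failing level `m₁ ≥ 2`; `m₀ := m₁ - 1 = ⌊δ⌋`
  set m₁ := Nat.find hfail with hm₁
  have hm₁fail : ¬ P m₁ := Nat.find_spec hfail
  have hm₁min : ∀ m, m < m₁ → P m := fun m hm => by
    have := Nat.find_min hfail (hm₁ ▸ hm)
    simpa using this
  have hm₁2 : 2 ≤ m₁ := by
    by_contra hlt
    push Not at hlt
    interval_cases m₁
    · exact hm₁fail hP0
    · exact hm₁fail hP1
  set m₀ := m₁ - 1 with hm₀
  have hm₀1 : 1 ≤ m₀ := by omega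
  have hPm₀ : P m₀ := hm₁min m₀ (by omega)
  have hfail₀ : ¬ P (m₀ + 1) := by
    rw [show m₀ + 1 = m₁ by omega]
    exact hm₁fail
  -- the witness of the failure at `m₀ + 1`
  obtain ⟨E₀, hE₀x, hE₀g, hE₀lt⟩ : ∃ E₀ : Fin (n + 1) →₀ ℕ, AxisPolyhedron.xDeg E₀ < d ∧
      MvPowerSeries.coeff E₀ g ≠ 0 ∧ E₀ (Fin.last n) < (m₀ + 1) * (d - AxisPolyhedron.xDeg E₀) := by
    by_contra hno
    push Not at hno
    exact hfail₀ fun E hEx hEg => hno E hEx hEg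
  by_cases hpm₀ : p ∣ m₀
  · -- `p ∣ ⌊δ⌋`: step down to `m₀ - 1`
    have hpm : 2 ≤ m₀ := le_trans hp.two_le (Nat.le_of_dvd (by omega) hpm₀)
    refine ⟨m₀ - 1, by omega, fun h => ?_, fun E hEx hEg => ?_, E₀, hE₀x, hE₀g, ?_⟩
    · have h1 : p ∣ m₀ - (m₀ - 1) := Nat.dvd_sub hpm₀ h
      rw [show m₀ - (m₀ - 1) = 1 by omega] at h1
      exact hp.one_lt.ne' (Nat.dvd_one.mp h1)
    · exact le_trans (Nat.mul_le_mul_right _ (Nat.sub_le m₀ 1)) (hPm₀ E hEx hEg)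
    · rw [show m₀ - 1 + 2 = m₀ + 1 by omega]
      exact hE₀lt
  · -- `p ∤ ⌊δ⌋`: take `m₀`
    refine ⟨m₀, hm₀1, hpm₀, hPm₀, E₀, hE₀x, hE₀g, lt_of_lt_of_le hE₀lt ?_⟩
    exact Nat.mul_le_mul_right _ (by omega)

end Summit.ResolutionOfSingularities.ResolutionOfSingularities.Theorems
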